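import Summits.CriticalPhenomena.Ising3DConformalLimit.Theorems.PerfectScreeningScreeningDichotomy
import HarnessLib

/-!
# Route `PerfectScreening`: the screening dichotomy off a finite exceptional set
# (`ScreeningDichotomyEventual`, stmt-CriticalPhenomena-13888)

THEOREM-ONLY file (no definitions, no named facts). Closes the support item
`Summit.CriticalPhenomena.Ising3DConformalLimit.Theses.PerfectScreening.ScreeningDichotomyEventual`:

  `GreenAsymptotics → EventuallySubharmonic → (∃ c > 0, ∀ x ≠ 0, c/‖x‖ ≤ G x) ∨ (‖x‖ G x → 0 cofinitely)`,

with `G = criticalTwoPoint 3 = ⟨σ₀σ_x⟩⁺_{β_c(3)}` and `EventuallySubharmonic = ∃ R, ∀ x, R < ‖x‖ → Δ G (x) ≥ 0`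
(lattice subharmonicity of `G` off a finite box — the pre-filed repair of crux r2 `SubharmonicOffOrigin`).

## Proof

The same case split as the tree proof of `ScreeningDichotomy` (item 1348,
`PerfectScreeningScreeningDichotomy.lean`):

* if non-saturation `NonSat` (`∀ ε > 0, frequently n·G(n e₁) < ε`) FAILS, then `n G(n e₁) ≥ ε > 0` for all
  large `n` and the Messager–Miracle-Solé comparison gives the pointwise Coulomb bound
  (`coulomb_of_eventually_axis`) — this branch uses no subharmonicity at all;
* if `NonSat` HOLDS, the exterior maximum principle of `screeningUpgrade_proof` (item 1346,
  `PerfectScreeningScreeningUpgrade.lean`) gives perfect screening `‖x‖ G(x) → 0`. That argument compares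
  `G` with `λ G₀` on the EXTERIOR `{‖x‖_∞ > n}` of a box `Λ_n` on whose boundary `G` is small, and it uses
  `Δ G ≥ 0` only on that exterior; since the non-saturated scale `n` may be taken as large as we please, in
  particular `n ≥ ⌈R⌉₊`, subharmonicity beyond radius `R` suffices verbatim (`screeningUpgrade_eventual`).

No Riesz decomposition `G = G₀ ∗ μ₀ - G₀ ∗ ν` is needed.

References: G. F. Lawler, *Intersections of Random Walks* (1991), §1.4–1.5; G. F. Lawler, V. Limic,
*Random Walk: A Modern Introduction* (2010), §4.3, §6.1–6.2 (maximum principle, `ΔG₀ = -δ₀`);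
A. Messager, S. Miracle-Solé, J. Stat. Phys. 17 (1977) 245–262; M. Aizenman, H. Duminil-Copin,
Ann. of Math. 194 (2021), §5.1 eq. (5.3).
-/

noncomputable section

namespace Summit.CriticalPhenomena.Ising3DConformalLimit.Theorems.PerfectScreening

open Literature.Probability.LatticeModels Filter Finset
open scoped Topology

/-- **Perfect screening from non-saturation under EVENTUAL subharmonicity.** If `G₀ = latticeGreen/2`
(the Green function of the graph Laplacian of `ℤ³`) has Coulomb asymptotics `|G₀(x) - a/|x|₂| ≤ K/|x|₂²`
with `a > 0`, the critical two-point function `G = ⟨σ₀σ_x⟩⁺_{β_c(3)}` is lattice-subharmonic on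
`{‖x‖ > R}`, and `liminf_n n·G(n e₁) = 0`, then `‖x‖·G(x) → 0` along the cofinite filter of `ℤ³`.
Proof: the exterior maximum principle of `screeningUpgrade_proof` for `G - λG₀` outside a box `Λ_n`
with `n ≥ ⌈R⌉₊` a non-saturated scale (module docstring). [folklore] -/
theorem screeningUpgrade_eventual {a K R : ℝ} (ha : 0 < a)
    (hGA : ∀ x : Site 3, x ≠ 0 →
      |latticeGreen x / 2 - a / Real.sqrt (∑ i, ((x i : ℤ) : ℝ) ^ 2)| ≤ K / (∑ i, ((x i : ℤ) : ℝ) ^ 2))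
    (hSubH : ∀ x : Site 3, R < ‖x‖ → 6 * criticalTwoPoint 3 x ≤
      ∑ i : Fin 3, (criticalTwoPoint 3 (x + Pi.single i 1) + criticalTwoPoint 3 (x - Pi.single i 1)))
    (hNonSat : ∀ ε : ℝ, 0 < ε →
      ∃ᶠ n : ℕ in Filter.atTop, (n : ℝ) * criticalTwoPoint 3 (Pi.single 0 (n : ℤ)) < ε) :
    Tendsto (fun x : Site 3 => ‖x‖ * criticalTwoPoint 3 x) cofinite (𝓝 0) := by
  -- notation
  set G : Site 3 → ℝ := criticalTwoPoint 3 with hG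
  set G₀ : Site 3 → ℝ := fun x => latticeGreen x / 2 with hG₀
  have h3 : (3 : ℕ) ≤ 3 := le_rfl
  -- inputs: `G ≥ 0`, `G → 0`, `G₀ → 0`, `Δ G ≥ 0` beyond radius `R`, `Δ G₀ ≤ 0`
  have hGnn : ∀ x, 0 ≤ G x := fun x => twoPointPlus_nonneg_of_gks (criticalBeta_nonneg 3) x
  have hGlim : Tendsto G cofinite (𝓝 0) := criticalTwoPoint_tendsto_zero_cofinite
  have hG₀lim : Tendsto G₀ cofinite (𝓝 0) := by
    simpa using (tendsto_latticeGreen_cofinite 3 h3).div_const 2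
  have hΔG : ∀ x : Site 3, R < ‖x‖ → 0 ≤ latticeLaplacianZd G x := by
    intro x hx
    rw [latticeLaplacianZd_nonneg_iff]
    have h := hSubH x hx
    push_cast
    linarith
  have hΔG₀ : ∀ x : Site 3, latticeLaplacianZd G₀ x ≤ 0 := by
    intro x
    rw [hG₀, latticeLaplacianZd_half_latticeGreen 3 h3 x]
    split_ifs <;> norm_num
  -- the `ε`-argument
  rw [Metric.tendsto_nhds]
  intro ε hε
  set ε' : ℝ := ε / 16 with hε'
  have hε'0 : 0 < ε' := by positivity
  set R₀ : ℝ := 2 * max K 0 / a with hR₀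
  -- a large non-saturated axial scale `n`, beyond both `R₀` and the exceptional radius `R`
  obtain ⟨n, hn, hnG⟩ :=
    Filter.frequently_atTop.1 (hNonSat ε' hε'0) (max (max 1 ⌈R₀⌉₊) ⌈R⌉₊)
  have hn1 : 1 ≤ n := le_of_max_le_left (le_of_max_le_left hn)
  have hnR₀ : R₀ ≤ (n : ℝ) :=
    (Nat.le_ceil R₀).trans (by exact_mod_cast le_of_max_le_right (le_of_max_le_left hn))
  have hnR : R ≤ (n : ℝ) := (Nat.le_ceil R).trans (by exact_mod_cast le_of_max_le_right hn)
  have hn0 : (0 : ℝ) < n := by exact_mod_cast hn1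
  -- the comparison function `λ G₀`, `λ = 4ε'/a`
  set lam : ℝ := 4 * ε' / a with hlam
  have hlam0 : 0 < lam := by positivity
  have hcomp : ∀ x : Site 3, n ≤ Site.supNorm x → G x ≤ lam * G₀ x := by
    refine le_on_exterior_of_le_on_sphere (d := 3) (by norm_num) (v := fun x => lam * G₀ x)
      (fun x hx => hΔG x ?_) (fun x _ => ?_) (fun y hy => ?_) hGlim ?_
    · -- `R < ‖x‖` on the exterior `‖x‖_∞ > n ≥ R`
      rw [Site.norm_eq_supNorm]
      exact hnR.trans_lt (by exact_mod_cast hx)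
    · -- `Δ (λ G₀) = λ Δ G₀ ≤ 0`
      rw [latticeLaplacianZd_const_mul]
      exact mul_nonpos_of_nonneg_of_nonpos hlam0.le (hΔG₀ x)
    · -- on the sphere: `G y ≤ G (n e₁) < ε'/n ≤ λ G₀ y`
      have hy0 : y ≠ 0 := by
        intro hy0
        rw [hy0, Site.supNorm_eq_zero_iff.2 rfl] at hy
        omega
      have hyR : R₀ ≤ (Site.supNorm y : ℝ) := by rw [hy]; exact hnR₀
      have hlow := (green_window_of_asymptotics ha hGA hy0 hyR).1
      rw [hy] at hlow
      have h1 : G y < ε' / n := by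
        calc G y ≤ G (Pi.single 0 (n : ℤ)) := criticalTwoPoint_three_le_axis hy
          _ < ε' / n := by
            rw [lt_div_iff₀ hn0, mul_comm]
            exact hnG
      have h2 : ε' / n ≤ lam * G₀ y := by
        calc ε' / n = lam * (a / (4 * n)) := by
              rw [hlam]
              field_simp
          _ ≤ lam * G₀ y := mul_le_mul_of_nonneg_left hlow hlam0.le
      exact (h1.trans_le h2).le
    · simpa using hG₀lim.const_mul lam
  -- conclusion: `‖x‖ G x ≤ 8 ε' < ε` off the box `Λ_n`
  rw [eventually_cofinite]
  refine (box 3 n).finite_toSet.subset fun x hx => ?_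
  rw [Finset.mem_coe, mem_box_iff_supNorm_le]
  by_contra hxn
  apply hx
  have hnx : n ≤ Site.supNorm x := by omega
  have hx0 : x ≠ 0 := by
    intro hx0
    rw [hx0, Site.supNorm_eq_zero_iff.2 rfl] at hnx
    omega
  set N : ℝ := (Site.supNorm x : ℝ) with hN
  have hN0 : 0 < N := by
    rw [hN]; exact_mod_cast one_le_supNorm_of_ne_zero hx0
  have hxR : R₀ ≤ N := hnR₀.trans (by rw [hN]; exact_mod_cast hnx)
  have hup := (green_window_of_asymptotics ha hGA hx0 hxR).2
  have hGx : G x ≤ 8 * ε' / N := by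
    calc G x ≤ lam * G₀ x := hcomp x hnx
      _ ≤ lam * (2 * a / N) := mul_le_mul_of_nonneg_left hup hlam0.le
      _ = 8 * ε' / N := by rw [hlam]; field_simp; ring
  rw [Real.dist_eq, sub_zero, Site.norm_eq_supNorm, ← hN,
    abs_of_nonneg (mul_nonneg hN0.le (hGnn x))]
  calc N * G x ≤ N * (8 * ε' / N) := mul_le_mul_of_nonneg_left hGx hN0.le
    _ = 8 * ε' := by field_simp
    _ < ε := by rw [hε']; linarith

/-- **The screening dichotomy off a finite exceptional set** (item `stmt-CriticalPhenomena-13888`,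
exact signature): granting the `a/|x|` asymptotics of the Green function of the graph Laplacian of `ℤ³`
and lattice-subharmonicity of `G = ⟨σ₀σ_x⟩⁺_{β_c(3)}` beyond some radius `R`, EITHER `c/‖x‖ ≤ G(x)` for
all `x ≠ 0` (Coulomb) OR `‖x‖G(x) → 0` (perfect screening). Case split on non-saturation
`liminf_n n G(n e₁) = 0`: `screeningUpgrade_eventual` in one case, Messager–Miracle-Solé
(`coulomb_of_eventually_axis`) in the other. [folklore] -/
theorem screeningDichotomyEventual_proof :
    Summit.CriticalPhenomena.Ising3DConformalLimit.Theses.PerfectScreening.ScreeningDichotomyEventual := by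
  unfold Summit.CriticalPhenomena.Ising3DConformalLimit.Theses.PerfectScreening.ScreeningDichotomyEventual
  rintro ⟨a, K, ha, hGA⟩ ⟨R, hSubH⟩
  by_cases hNS : ∀ ε : ℝ, 0 < ε →
      ∃ᶠ n : ℕ in Filter.atTop, (n : ℝ) * criticalTwoPoint 3 (Pi.single 0 (n : ℤ)) < ε
  · right
    -- the inline Brillouin-zone integral is `latticeGreen / 2`
    have hGA' : ∀ x : Site 3, x ≠ 0 →
        |latticeGreen x / 2 - a / Real.sqrt (∑ i, ((x i : ℤ) : ℝ) ^ 2)| ≤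
          K / (∑ i, ((x i : ℤ) : ℝ) ^ 2) := by
      intro x hx
      have h := hGA x hx
      rwa [setIntegral_pi_cos_div_eq_half_latticeGreen x] at h
    exact screeningUpgrade_eventual ha hGA' hSubH hNS
  · left
    push Not at hNS
    obtain ⟨ε, hε, hev⟩ := hNS
    obtain ⟨N₀, hN₀⟩ := Filter.eventually_atTop.1 hev
    exact coulomb_of_eventually_axis hε hN₀

end Summit.CriticalPhenomena.Ising3DConformalLimit.Theorems.PerfectScreening
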